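import Summits.Ventures.WeilGRH.ChristoffelCertificateCheck
import Mathlib.Topology.Algebra.Module.Cardinality
import HarnessLib

/-!
# rh-explicit (venture WeilGRH): CHRISTOFFEL CERTIFICATES, IV — the TAIL MAJORANT of a lower-bound certificate
  (window sums, the integer transform conditions, and the domination `D²·W_c² ≤ W_d²` beyond `πm/a`; weil-3 gen17)

Cell `rh-explicit`, WEIL TRACK (structure seat weil-3, gen17).  Parts I–III (`ChristoffelCertificate`, `…Check`, `…Mul`)
turn one coefficient vector on a block of Yoshida's Gram matrix into an UPPER bound for the mass a Weil measure of the
rung gives to a block.  Parts IV–VI are the converse direction («at least one line in the window», hence EXACTLY one).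
The lower bound needs an a-priori control of the measure BEYOND the certified radius; it is obtained from a second
vector, the TAIL MAJORANT `d`, tied to the test vector `c` by an algebraic transform in lattice units `s = at/π`:

  `Q_d(s)·(s² − m²) = D·Q_c(s)·(s² − h)`,  `Q_c(s) = Σ_n (−1)^n c_n/(s + n)`,  `0 ≤ h < m²`,

so that `|d̂| ≥ D|ĉ|` wherever `s² ≥ m²`.  This file: the window sum `W_c(t) = Σ c_j sinc(at + πn_j)` of a certificate
vector and its profile `‖ĉ(½+it)‖² = 2a·W_c²` (`Christoffel.profile_eq_wsum`); the transform as finitely many INTEGER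
identities (`Christoffel.domConds`: per mode `d_i(n_i² − m²)hd = D c_i(n_i² hd − hn)`, and the two moment identities
`Σσ_i d_i = DΣσ_i c_i`, `Σσ_i n_i d_i = DΣσ_i n_i c_i`); the identity `W_d·((at)² − π²m²) = D·W_c·((at)² − π²h)` off the
lattice by partial fractions (`wsum_transform_identity_of_ne`: every mode contributes `sin(at)·σ_i(d_i − Dc_i)(at − πn_i)`, and the
two moments cancel the sum) and everywhere by continuity (`wsum_transform_identity`); and ★ `Christoffel.sq_wsum_dominates`:
**`D²·W_c(t)² ≤ W_d(t)²` for `π m ≤ |at|`**.  Pure algebra/analysis of finite trigonometric sums; RH-free; standard axioms;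
nothing here bears on the truth of RH.
-/

set_option autoImplicit false

noncomputable section

open Complex Set MeasureTheory
open scoped Real ENNReal

namespace Summit.Ventures.WeilGRH

open Literature.NumberTheory.LFunctions
open Literature.NumberTheory.LFunctions.Yoshida1992 (chi gramCoeff freq PrimeLen PrimeData)
open Literature.NumberTheory.LFunctions.Yoshida1992.Encl (Consts IdxRec ConstsValid OffValid DiagValid IdxValid TabValid
  tget gramBox mem_gramBox sgn neg_one_zpow_eq_sgn mem_of_eq)
open Literature.Analysis.ValidatedNumerics.NumericsMP (MI MC)
open Summit.RiemannHypothesis.RiemannHypothesis.Theorems.WeilFormatC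
open Summit.RiemannHypothesis.RiemannHypothesis.Theorems.WeilBochnerMeasure (weilWindowForm_sum_smul_chi_eq_integral
  sum_mul_mul_gramCoeff_eq_integral measure_Icc_lt_top)

variable {a : ℝ}

namespace Christoffel

variable {S : ℕ} {ks : List PrimeLen} {C : Consts} {tab : List IdxRec} {Nt : ℕ}

/-! ## The window sum of a coefficient list and its profile -/

/-- The window sum `W_c(t) = Σ_{j<2N+1} c_j·sinc(at + πn_j)` of a coefficient list (`‖ĉ(½+it)‖² = 2a·W_c(t)²`). -/
def wsum (a : ℝ) (N : ℕ) (c : List ℤ) (t : ℝ) : ℝ :=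
  ∑ j ∈ Finset.range (2 * N + 1), ((coefAt c j : ℤ) : ℝ) * Real.sinc (a * t + π * (mode N j))

/-- `W_c` is continuous. -/
theorem continuous_wsum (a : ℝ) (N : ℕ) (c : List ℤ) : Continuous (wsum a N c) := by
  unfold wsum
  refine continuous_finsetSum _ fun j _ ↦ continuous_const.mul (Real.continuous_sinc.comp ?_)
  exact (continuous_const.mul continuous_id).add continuous_const

/-- **The profile is `2a·W_c²`**: `‖(Σ_n x_n χ_n)^(½+it)‖² = 2a·W_c(t)²` for the vector of a certificate. -/
theorem profile_eq_wsum (ha0 : 0 < a) (N : ℕ) (c : List ℤ) (t : ℝ) :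
    ‖weilMellin (∑ n ∈ modes N, (coefFun N c n : ℂ) • chi a n) (1 / 2 + t * I)‖ ^ 2 = 2 * a * wsum a N c t ^ 2 := by
  rw [norm_sq_weilMellin_sum_smul_chi_eq_sinc ha0]
  unfold modes wsum
  rw [Finset.sum_image (mode_injOn N)]
  congr 2
  refine Finset.sum_congr rfl fun j _ ↦ ?_
  rw [coefFun_mode]

/-- The Gram form of a certificate vector, written over the index range (the shape `mem_formBox` encloses). -/
theorem gramForm_eq_rangeSum (N : ℕ) (c : List ℤ) :
    ∑ n ∈ modes N, ∑ k ∈ modes N, coefFun N c n * coefFun N c k * gramCoeff a n k =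
      ∑ i ∈ Finset.range (2 * N + 1), ∑ j ∈ Finset.range (2 * N + 1),
        gramCoeff a (mode N i) (mode N j) * ((coefAt c i * coefAt c j : ℤ) : ℝ) := by
  unfold modes
  rw [Finset.sum_image (mode_injOn N)]
  refine Finset.sum_congr rfl fun i _ ↦ ?_
  rw [Finset.sum_image (mode_injOn N)]
  refine Finset.sum_congr rfl fun j _ ↦ ?_
  rw [coefFun_mode, coefFun_mode]
  push_cast
  ring

/-! ## The tail majorant: integer transform conditions and the domination they give -/

/-- `Σ_{i<k} f i` by structural recursion (what the kernel evaluates). -/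
def zsum (f : ℕ → ℤ) : ℕ → ℤ
  | 0 => 0
  | k + 1 => zsum f k + f k

/-- `zsum f k = Σ_{i<k} f i`. -/
theorem zsum_eq (f : ℕ → ℤ) (k : ℕ) : zsum f k = ∑ i ∈ Finset.range k, f i := by
  induction k with
  | zero => simp [zsum]
  | succ k ih => rw [zsum, ih, Finset.sum_range_succ]

/-- **The transform conditions** tying the tail majorant `d` to `c` (all in `ℤ`; `h = hn/hd`):
`0 < D`, `0 < hd`, `h < m²`; per mode `d_i·(n_i² − m²)·hd = D·c_i·(n_i²·hd − hn)` (at `n_i = ±m` this forces `c_i = 0`);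
and the two moment identities `Σ σ_i d_i = D Σ σ_i c_i`, `Σ σ_i n_i d_i = D Σ σ_i n_i c_i` (`σ_i = (−1)^{n_i}`). -/
def domConds (N : ℕ) (c d : List ℤ) (D m hn hd : ℕ) : Bool :=
  decide (0 < D) && decide (0 < hd) && decide (hn < m * m * hd) &&
  ((List.range (2 * N + 1)).all fun i ↦
    decide (coefAt d i * (mode N i * mode N i - (m : ℤ) * m) * (hd : ℤ) =
      (D : ℤ) * coefAt c i * (mode N i * mode N i * (hd : ℤ) - (hn : ℤ)))) &&
  decide (zsum (fun i ↦ sgn (mode N i) 0 * coefAt d i) (2 * N + 1) =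
    (D : ℤ) * zsum (fun i ↦ sgn (mode N i) 0 * coefAt c i) (2 * N + 1)) &&
  decide (zsum (fun i ↦ sgn (mode N i) 0 * mode N i * coefAt d i) (2 * N + 1) =
    (D : ℤ) * zsum (fun i ↦ sgn (mode N i) 0 * mode N i * coefAt c i) (2 * N + 1))

/-- One mode of the window sum off the lattice: `c·sinc(u + πn) = sin(u)·σ_n c/(u + πn)`. -/
theorem coef_mul_sinc_eq {u : ℝ} {n : ℤ} (hy : u + π * n ≠ 0) (cf : ℤ) :
    (cf : ℝ) * Real.sinc (u + π * n) = Real.sin u * ((sgn n 0 * cf : ℤ) : ℝ) / (u + π * n) := by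
  rw [Real.sinc_of_ne_zero hy]
  have hsg : Real.sin (u + π * n) = Real.sin u * (sgn n 0 : ℤ) := by
    rw [show u + π * n = u + n * π by ring, Real.sin_add_int_mul_pi, ← neg_one_zpow_eq_sgn, add_zero, mul_comm]
  rw [hsg]
  push_cast
  ring

/-- **The transform identity off the lattice**: under `domConds`,
`W_d(t)·((at)² − π²m²) = D·W_c(t)·((at)² − π²h)` whenever `at + πn_i ≠ 0` for all modes. -/
theorem wsum_transform_identity_of_ne {N : ℕ} {c d : List ℤ} {D m hn hd : ℕ}
    (hdom : domConds N c d D m hn hd = true) {t : ℝ} (ht : ∀ i < 2 * N + 1, a * t + π * (mode N i) ≠ 0) :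
    wsum a N d t * ((a * t) ^ 2 - π ^ 2 * (m : ℝ) ^ 2) =
      (D : ℝ) * wsum a N c t * ((a * t) ^ 2 - π ^ 2 * ((hn : ℝ) / hd)) := by
  unfold domConds at hdom
  simp only [Bool.and_eq_true, decide_eq_true_eq, List.all_eq_true, List.mem_range] at hdom
  obtain ⟨⟨⟨⟨⟨hD, hhd⟩, hh⟩, hii⟩, hiii⟩, hiv⟩ := hdom
  rw [zsum_eq, zsum_eq] at hiii hiv
  have hhdR : (0 : ℝ) < hd := by exact_mod_cast hhd
  set u : ℝ := a * t with hu
  -- termwise: `d_i sinc(y_i)(u² − π²m²) − D c_i sinc(y_i)(u² − π²h) = sin u · σ_i (d_i − D c_i)(u − π n_i)`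
  have hterm : ∀ i ∈ Finset.range (2 * N + 1),
      ((coefAt d i : ℤ) : ℝ) * Real.sinc (u + π * (mode N i)) * (u ^ 2 - π ^ 2 * (m : ℝ) ^ 2) -
        (D : ℝ) * (((coefAt c i : ℤ) : ℝ) * Real.sinc (u + π * (mode N i))) * (u ^ 2 - π ^ 2 * ((hn : ℝ) / hd)) =
      Real.sin u * (((sgn (mode N i) 0 * (coefAt d i - (D : ℤ) * coefAt c i) : ℤ) : ℝ) * (u - π * (mode N i))) := by
    intro i hi
    have hy := ht i (Finset.mem_range.1 hi)
    have h2 := hii i (Finset.mem_range.1 hi)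
    have h2R : ((coefAt d i : ℤ) : ℝ) * ((mode N i : ℝ) ^ 2 - (m : ℝ) ^ 2) =
        (D : ℝ) * ((coefAt c i : ℤ) : ℝ) * ((mode N i : ℝ) ^ 2 - (hn : ℝ) / hd) := by
      have h2' : (((coefAt d i * (mode N i * mode N i - (m : ℤ) * m) * (hd : ℤ) : ℤ) : ℝ)) =
          (((D : ℤ) * coefAt c i * (mode N i * mode N i * (hd : ℤ) - (hn : ℤ)) : ℤ) : ℝ) := by rw [h2]
      push_cast at h2'
      field_simp
      linear_combination h2'
    rw [coef_mul_sinc_eq hy, coef_mul_sinc_eq hy]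
    have key : ((coefAt d i : ℤ) : ℝ) * (u ^ 2 - π ^ 2 * (m : ℝ) ^ 2) -
        (D : ℝ) * ((coefAt c i : ℤ) : ℝ) * (u ^ 2 - π ^ 2 * ((hn : ℝ) / hd)) =
        (((coefAt d i : ℤ) : ℝ) - (D : ℝ) * ((coefAt c i : ℤ) : ℝ)) * (u - π * (mode N i)) * (u + π * (mode N i)) := by
      linear_combination (π ^ 2) * h2R
    push_cast
    calc Real.sin u * ((sgn (mode N i) 0 : ℝ) * ((coefAt d i : ℤ) : ℝ)) / (u + π * (mode N i)) *
            (u ^ 2 - π ^ 2 * (m : ℝ) ^ 2) -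
          (D : ℝ) * (Real.sin u * ((sgn (mode N i) 0 : ℝ) * ((coefAt c i : ℤ) : ℝ)) / (u + π * (mode N i))) *
            (u ^ 2 - π ^ 2 * ((hn : ℝ) / hd))
        = Real.sin u * (sgn (mode N i) 0 : ℝ) / (u + π * (mode N i)) *
            (((coefAt d i : ℤ) : ℝ) * (u ^ 2 - π ^ 2 * (m : ℝ) ^ 2) -
              (D : ℝ) * ((coefAt c i : ℤ) : ℝ) * (u ^ 2 - π ^ 2 * ((hn : ℝ) / hd))) := by ring
      _ = Real.sin u * (sgn (mode N i) 0 : ℝ) / (u + π * (mode N i)) *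
            ((((coefAt d i : ℤ) : ℝ) - (D : ℝ) * ((coefAt c i : ℤ) : ℝ)) * (u - π * (mode N i)) * (u + π * (mode N i))) := by
          rw [key]
      _ = Real.sin u * ((sgn (mode N i) 0 : ℝ) * (((coefAt d i : ℤ) : ℝ) - (D : ℝ) * ((coefAt c i : ℤ) : ℝ)) *
            (u - π * (mode N i))) := by
          field_simp
  -- sum the termwise identity
  have hsum : wsum a N d t * (u ^ 2 - π ^ 2 * (m : ℝ) ^ 2) - (D : ℝ) * wsum a N c t * (u ^ 2 - π ^ 2 * ((hn : ℝ) / hd)) =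
      Real.sin u * ∑ i ∈ Finset.range (2 * N + 1),
        (((sgn (mode N i) 0 * (coefAt d i - (D : ℤ) * coefAt c i) : ℤ) : ℝ) * (u - π * (mode N i))) := by
    unfold wsum
    rw [Finset.sum_mul, mul_assoc (D : ℝ), Finset.sum_mul, Finset.mul_sum, ← Finset.sum_sub_distrib, Finset.mul_sum]
    refine Finset.sum_congr rfl fun i hi ↦ ?_
    rw [← hterm i hi]
    ring
  -- the two moment identities kill the sum
  have hmom : ∑ i ∈ Finset.range (2 * N + 1),
      (((sgn (mode N i) 0 * (coefAt d i - (D : ℤ) * coefAt c i) : ℤ) : ℝ) * (u - π * (mode N i))) = 0 := by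
    have e : ∀ i ∈ Finset.range (2 * N + 1),
        (((sgn (mode N i) 0 * (coefAt d i - (D : ℤ) * coefAt c i) : ℤ) : ℝ) * (u - π * (mode N i))) =
          u * (((sgn (mode N i) 0 * coefAt d i : ℤ) : ℝ) - (D : ℝ) * ((sgn (mode N i) 0 * coefAt c i : ℤ) : ℝ)) -
          π * (((sgn (mode N i) 0 * mode N i * coefAt d i : ℤ) : ℝ) -
            (D : ℝ) * ((sgn (mode N i) 0 * mode N i * coefAt c i : ℤ) : ℝ)) := by
      intro i _
      push_cast
      ring
    rw [Finset.sum_congr rfl e, Finset.sum_sub_distrib, ← Finset.mul_sum, ← Finset.mul_sum, Finset.sum_sub_distrib,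
      Finset.sum_sub_distrib, ← Finset.mul_sum, ← Finset.mul_sum]
    have h3 : ∑ i ∈ Finset.range (2 * N + 1), ((sgn (mode N i) 0 * coefAt d i : ℤ) : ℝ) =
        (D : ℝ) * ∑ i ∈ Finset.range (2 * N + 1), ((sgn (mode N i) 0 * coefAt c i : ℤ) : ℝ) := by
      have := congrArg (fun z : ℤ ↦ (z : ℝ)) hiii
      push_cast at this ⊢
      exact this
    have h4 : ∑ i ∈ Finset.range (2 * N + 1), ((sgn (mode N i) 0 * mode N i * coefAt d i : ℤ) : ℝ) =
        (D : ℝ) * ∑ i ∈ Finset.range (2 * N + 1), ((sgn (mode N i) 0 * mode N i * coefAt c i : ℤ) : ℝ) := by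
      have := congrArg (fun z : ℤ ↦ (z : ℝ)) hiv
      push_cast at this ⊢
      exact this
    rw [h3, h4]
    ring
  rw [hmom, mul_zero, sub_eq_zero] at hsum
  exact hsum

/-- **The transform identity for every `t`** (both sides are continuous and the lattice is finite). -/
theorem wsum_transform_identity (ha0 : 0 < a) {N : ℕ} {c d : List ℤ} {D m hn hd : ℕ}
    (hdom : domConds N c d D m hn hd = true) (t : ℝ) :
    wsum a N d t * ((a * t) ^ 2 - π ^ 2 * (m : ℝ) ^ 2) =
      (D : ℝ) * wsum a N c t * ((a * t) ^ 2 - π ^ 2 * ((hn : ℝ) / hd)) := by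
  set L : Set ℝ := (((Finset.range (2 * N + 1)).image fun i ↦ -(π * (mode N i : ℝ)) / a : Finset ℝ) : Set ℝ) with hL
  have hdense : Dense Lᶜ := Set.Countable.dense_compl ℝ (Finset.finite_toSet _).countable
  have hf : Continuous fun t : ℝ ↦ wsum a N d t * ((a * t) ^ 2 - π ^ 2 * (m : ℝ) ^ 2) :=
    (continuous_wsum a N d).mul (((continuous_const.mul continuous_id).pow 2).sub continuous_const)
  have hg : Continuous fun t : ℝ ↦ (D : ℝ) * wsum a N c t * ((a * t) ^ 2 - π ^ 2 * ((hn : ℝ) / hd)) :=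
    (continuous_const.mul (continuous_wsum a N c)).mul
      (((continuous_const.mul continuous_id).pow 2).sub continuous_const)
  have heq := Continuous.ext_on hdense hf hg fun t ht ↦ by
    refine wsum_transform_identity_of_ne hdom fun i hi h0 ↦ ht ?_
    rw [hL, Finset.coe_image]
    refine ⟨i, by simpa using hi, ?_⟩
    field_simp
    linarith
  exact congrFun heq t

/-- ★ **TAIL DOMINATION.**  Under the transform conditions, `D²·W_c(t)² ≤ W_d(t)²` for every `t` with `π m ≤ |a t|`
(i.e. `|t| ≥ πm/a`): there `(at)² − π²h ≥ (at)² − π²m² ≥ 0`. -/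
theorem sq_wsum_dominates (ha0 : 0 < a) {N : ℕ} {c d : List ℤ} {D m hn hd : ℕ}
    (hdom : domConds N c d D m hn hd = true) {t : ℝ} (ht : π * m ≤ |a * t|) :
    (D : ℝ) ^ 2 * wsum a N c t ^ 2 ≤ wsum a N d t ^ 2 := by
  have hid := wsum_transform_identity ha0 hdom t
  have hdom' := hdom
  unfold domConds at hdom'
  simp only [Bool.and_eq_true, decide_eq_true_eq, List.all_eq_true, List.mem_range] at hdom'
  obtain ⟨⟨⟨⟨⟨hD, hhd⟩, hh⟩, -⟩, -⟩, -⟩ := hdom'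
  have hhdR : (0 : ℝ) < hd := by exact_mod_cast hhd
  have hhR : (hn : ℝ) / hd < (m : ℝ) ^ 2 := by
    rw [div_lt_iff₀ hhdR]; exact_mod_cast (by nlinarith [hh] : hn < m ^ 2 * hd)
  have hsq : π ^ 2 * (m : ℝ) ^ 2 ≤ (a * t) ^ 2 := by
    have h0 : 0 ≤ π * m := by positivity
    calc π ^ 2 * (m : ℝ) ^ 2 = (π * m) ^ 2 := by ring
      _ ≤ |a * t| ^ 2 := pow_le_pow_left₀ h0 ht 2
      _ = (a * t) ^ 2 := sq_abs _
  rcases hsq.eq_or_lt with heq | hlt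
  · -- on the boundary `(at)² = π²m²` the identity forces `W_c(t) = 0`
    have h0 : (D : ℝ) * wsum a N c t * ((a * t) ^ 2 - π ^ 2 * ((hn : ℝ) / hd)) = 0 := by
      rw [← hid, ← heq, sub_self, mul_zero]
    have hpos : 0 < (a * t) ^ 2 - π ^ 2 * ((hn : ℝ) / hd) := by
      rw [← heq]; nlinarith [mul_pos (pow_pos Real.pi_pos 2) (sub_pos.2 hhR)]
    have hDpos : (0 : ℝ) < D := by exact_mod_cast hD
    have hc0 : wsum a N c t = 0 := by
      rcases mul_eq_zero.1 h0 with h1 | h1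
      · rcases mul_eq_zero.1 h1 with h2 | h2
        · exact absurd h2 hDpos.ne'
        · exact h2
      · exact absurd h1 hpos.ne'
    rw [hc0, zero_pow two_ne_zero, mul_zero]; exact sq_nonneg _
  · have hA : 0 < (a * t) ^ 2 - π ^ 2 * (m : ℝ) ^ 2 := sub_pos.2 hlt
    have hB : (a * t) ^ 2 - π ^ 2 * (m : ℝ) ^ 2 ≤ (a * t) ^ 2 - π ^ 2 * ((hn : ℝ) / hd) := by
      nlinarith [Real.pi_pos]
    -- `W_d = D W_c · B/A` with `B/A ≥ 1`
    have hsqid : wsum a N d t ^ 2 * ((a * t) ^ 2 - π ^ 2 * (m : ℝ) ^ 2) ^ 2 =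
        (D : ℝ) ^ 2 * wsum a N c t ^ 2 * ((a * t) ^ 2 - π ^ 2 * ((hn : ℝ) / hd)) ^ 2 := by
      have := congrArg (fun z : ℝ ↦ z ^ 2) hid
      simpa [mul_pow] using this
    have hmono : (D : ℝ) ^ 2 * wsum a N c t ^ 2 * ((a * t) ^ 2 - π ^ 2 * (m : ℝ) ^ 2) ^ 2 ≤
        (D : ℝ) ^ 2 * wsum a N c t ^ 2 * ((a * t) ^ 2 - π ^ 2 * ((hn : ℝ) / hd)) ^ 2 := by
      have h1 : ((a * t) ^ 2 - π ^ 2 * (m : ℝ) ^ 2) ^ 2 ≤ ((a * t) ^ 2 - π ^ 2 * ((hn : ℝ) / hd)) ^ 2 :=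
        pow_le_pow_left₀ hA.le hB 2
      exact mul_le_mul_of_nonneg_left h1 (by positivity)
    rw [← hsqid] at hmono
    exact le_of_mul_le_mul_right hmono (by positivity)

end Christoffel

end Summit.Ventures.WeilGRH

end
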